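import Summits.KontsevichZagierPeriods.KontsevichZagierPeriods.Theorems.FermatIsogenyBetaLinearSectorSixthsStubHalfSumDuplication
import Summits.KontsevichZagierPeriods.KontsevichZagierPeriods.Theorems.FermatIsogenyBetaLinearSectorSixthsStubSexticBeta
import Literature.NumberTheory.Transcendental.KZBetaChains
import HarnessLib

/-!
# `BetaLinearSector` (stmt-KontsevichZagierPeriods-3897), line `fermat-sector-transport` —
# stub `stub_link25_45` (link L2′ of the level-6 rung: `B(1/3,5/6) = (3/2)·2^{1/3}·B(2/3,5/6)`)

The LEVEL-6 rung of the crux `BetaLinearSector` (route FermatIsogeny) needs the coincidence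
`B(1/3,5/6) = (3/2)·2^{1/3}·B(2/3,5/6)` between `U = [(0,1), t^{-2/3}(1-t)^{-1/6}]` (class
`π²/Γ(1/3)³`, a second-kind period of `X³ + Y⁶ = 1`, which covers the genus-2 curve `n² = 1 + 4m⁶`
whose odd part is the twist `y² = x³ + 4` of `y² = x³ + 1` — the source of `2^{1/3}`) and
`V = [(0,1), (3/2)·2^{1/3}·t^{-1/3}(1-t)^{-1/6}]`.  THIS file realises it INSIDE the Kontsevich–Zagier
calculus [Kontsevich–Zagier 2001, §1.2] by the elementary chain `U ∼ P ∼ Q ∼ V` on `(0,1)`: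
(1) ONE change of variables `t = 1 - s⁶` of `(0,1)` onto `(0,1)` (rule (2), `|dt/ds| = 6s⁵`,
`(s⁶)^{-1/6} = s⁻¹`): `U ∼ P := [(0,1), 6s⁴(1-s⁶)^{-2/3}]`;
(2) ONE EXACT CORRECTION: `H(s) = -6s⁵(1-s⁶)^{1/3}/(1+s⁶)` is continuous on `[0,1]`, vanishes at
both ends, is `ℚ`-semialgebraic, and `H' = 6s⁴(1-s⁶)^{-2/3} - 36s⁴(1-s⁶)^{1/3}/(1+s⁶)²` on `(0,1)`;
so `D := [(0,1), H']` is a relation (ONE Newton–Leibniz move from the point plus the null boundary,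
`of_mem_relations_of_hasDerivAt`) and ONE integrand-additivity move gives
`P ∼ Q := [(0,1), 36s⁴(1-s⁶)^{1/3}/(1+s⁶)²]`;
(3) ONE RATIONAL change of variables `t = T(s) = ((1-s⁶)/(1+s⁶))²` of `(0,1)` onto `(0,1)`
(decreasing, `T' = -24s⁵(1-s⁶)/(1+s⁶)³`, `1 - T = 4s⁶/(1+s⁶)²`):
`T^{-1/3}(1-T)^{-1/6}|T'| = 24·2^{-1/3}·s⁴(1-s⁶)^{1/3}/(1+s⁶)²` and `(3/2)·2^{1/3}·24·2^{-1/3} = 36`,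
so `V` pulls back to `Q`: `Q ∼ V`.
`P`, `Q`, `D` are built here (integrands Euler–Mellin monomials in the positive polynomials `s`,
`1-s⁶`, `1+s⁶`, hence `ℚ`-semialgebraic; `P` integrable as the pull-back of `U`, `Q` bounded);
`U`, `V` are PINNED by domain and integrand.  Values: `B(1/3,5/6) = 3.2595… = (3/2)·2^{1/3}·1.7247…`.
References: M. Kontsevich, D. Zagier, *Periods* (2001), §1.2 rules (1)–(3); B. Gross, D. Rohrlich,
*Some results on the Mordell–Weil group of the Jacobian of the Fermat curve*, Invent. Math. 44
(1978), §1.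
-/

noncomputable section

namespace Summit.KontsevichZagierPeriods.FermatIsogeny.BetaLinearSector.Sixths

open Set MeasureTheory
open MvPolynomial (aeval X C)
open Literature.NumberTheory.Transcendental Literature.NumberTheory.Transcendental.KZ
open Summit.KontsevichZagierPeriods.HermiteRigidity.CMTwistQuasiPeriodTransfer
  (of_sub_of_mem_changeOfVariablesRel_dimOne image_fin_one of_mem_relations_of_hasDerivAt)
open Summit.KontsevichZagierPeriods.KontsevichZagierPeriods.Theorems.GKZLevelThree
  (isSemialgebraicFunOn_ratFun₁)

/-- `(x^{1/3})³ = x` for `0 ≤ x`. -/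
theorem link25_cbrt_pow_three {x : ℝ} (hx : 0 ≤ x) : (x ^ ((1:ℝ) / 3)) ^ 3 = x := by
  rw [← Real.rpow_natCast, ← Real.rpow_mul hx]
  norm_num

/-- `(x⁶)^{-1/3} = (x²)⁻¹` for `0 ≤ x`. -/
theorem link25_pow_six_rpow_neg_third {x : ℝ} (hx : 0 ≤ x) : (x ^ 6) ^ (-(1:ℝ) / 3) = (x ^ 2)⁻¹ := by
  rw [← Real.rpow_natCast x 6, ← Real.rpow_mul hx, show ((6:ℕ):ℝ) * (-(1:ℝ) / 3) = -2 by norm_num,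
    Real.rpow_neg hx, Real.rpow_two]

/-- `(x⁶)^{-1/6} = x⁻¹` for `0 ≤ x`. -/
theorem link25_pow_six_rpow_neg_sixth {x : ℝ} (hx : 0 ≤ x) : (x ^ 6) ^ (-(1:ℝ) / 6) = x⁻¹ := by
  rw [← Real.rpow_natCast x 6, ← Real.rpow_mul hx, show ((6:ℕ):ℝ) * (-(1:ℝ) / 6) = -1 by norm_num,
    Real.rpow_neg_one]

/-- `0 < 1 + s⁶`. -/
theorem link25_den_pos (s : ℝ) : 0 < 1 + s ^ 6 := by positivity

/-- The derivative of `s ↦ 1 - s⁶` is `-(6s⁵)`. -/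
theorem link25_sextic_hasDerivAt (s : ℝ) : HasDerivAt (fun s : ℝ => 1 - s ^ 6) (-(6 * s ^ 5)) s := by
  have h1 : HasDerivAt (fun s : ℝ => s ^ 6) (6 * s ^ 5) s := by simpa using hasDerivAt_pow 6 s
  exact h1.const_sub 1

/-- `s ↦ 1 - s⁶` maps `(0,1)` into `(0,1)`. -/
theorem link25_sextic_mem_Ioo {s : ℝ} (hs : s ∈ Ioo (0:ℝ) 1) : 1 - s ^ 6 ∈ Ioo (0:ℝ) 1 := by
  have h1 : 0 < s ^ 6 := pow_pos hs.1 6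
  have h2 : s ^ 6 < 1 := pow_lt_one₀ hs.1.le hs.2 (by norm_num)
  exact ⟨by linarith, by linarith⟩

/-- `s ↦ 1 - s⁶` is injective on `(0,1)`. -/
theorem link25_sextic_inj {p q : ℝ} (hp : p ∈ Ioo (0:ℝ) 1) (hq : q ∈ Ioo (0:ℝ) 1)
    (h : 1 - p ^ 6 = 1 - q ^ 6) : p = q :=
  (pow_left_inj₀ hp.1.le hq.1.le (by norm_num : (6:ℕ) ≠ 0)).1 (by linarith)

/-- `s ↦ 1 - s⁶` maps `(0,1)` ONTO `(0,1)` (`y = 1 - s⁶` for `s = (1-y)^{1/6}`). -/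
theorem link25_sextic_image : (fun s : ℝ => 1 - s ^ 6) '' Ioo (0:ℝ) 1 = Ioo 0 1 := by
  refine Subset.antisymm (by rintro _ ⟨s, hs, rfl⟩; exact link25_sextic_mem_Ioo hs) fun y hy => ?_
  have hy1 : 0 ≤ 1 - y := by linarith [hy.2]
  refine ⟨(1 - y) ^ ((6:ℕ)⁻¹ : ℝ), ⟨Real.rpow_pos_of_pos (by linarith [hy.2]) _,
    Real.rpow_lt_one hy1 (by linarith [hy.1]) (by norm_num)⟩, ?_⟩
  show 1 - ((1 - y) ^ ((6:ℕ)⁻¹ : ℝ)) ^ 6 = y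
  rw [Real.rpow_inv_natCast_pow hy1 (by norm_num)]
  ring

/-- The pull-back identity of move 1: for `0 < s < 1`,
`6s⁴(1-s⁶)^{-2/3} = (1-s⁶)^{-2/3}·(1-(1-s⁶))^{-1/6}·|-(6s⁵)|` (as `(s⁶)^{-1/6} = s⁻¹`). -/
theorem link25_sextic_pullback {s : ℝ} (hs : s ∈ Ioo (0:ℝ) 1) :
    6 * s ^ 4 * (1 - s ^ 6) ^ (-(2:ℝ) / 3) =
      (1 - s ^ 6) ^ (-(2:ℝ) / 3) * (1 - (1 - s ^ 6)) ^ (-(1:ℝ) / 6) * |-(6 * s ^ 5)| := by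
  have hs0 : 0 < s := hs.1
  rw [sub_sub_cancel, link25_pow_six_rpow_neg_sixth hs0.le, abs_neg, abs_of_pos (by positivity)]
  field_simp

/-- The integrand `6s⁴(1-s⁶)^{-2/3}` of `P` is integrable on `(0,1) ⊆ ℝ¹` as soon as the Beta
integrand `t^{-2/3}(1-t)^{-1/6}` is integrable on `(0,1)`: it is its pull-back along the injective
`C¹` map `t = 1 - s⁶` of `(0,1)` onto `(0,1)` (change of variables for integrability). -/
theorem link25_P_integrableOn
    (hg : IntegrableOn (fun t : ℝ => t ^ (-(2:ℝ) / 3) * (1 - t) ^ (-(1:ℝ) / 6)) (Ioo (0:ℝ) 1)) :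
    IntegrableOn (fun x : Fin 1 → ℝ => 6 * (x 0) ^ 4 * (1 - (x 0) ^ 6) ^ (-(2:ℝ) / 3))
      {x : Fin 1 → ℝ | x 0 ∈ Set.Ioo (0:ℝ) 1} := by
  rw [integrableOn_setOf_apply_mem_iff (g := fun s : ℝ => 6 * s ^ 4 * (1 - s ^ 6) ^ (-(2:ℝ) / 3))]
  have h := (integrableOn_image_iff_integrableOn_abs_deriv_smul measurableSet_Ioo
    (fun s _ => (link25_sextic_hasDerivAt s).hasDerivWithinAt)
    (fun p hp q hq hpq => link25_sextic_inj hp hq hpq)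
    (fun t : ℝ => t ^ (-(2:ℝ) / 3) * (1 - t) ^ (-(1:ℝ) / 6))).1 (by rw [link25_sextic_image]; exact hg)
  refine h.congr_fun (fun s hs => ?_) measurableSet_Ioo
  simp only [smul_eq_mul, link25_sextic_pullback hs]
  ring

/-- The derivative of the primitive `H(s) = -6s⁵(1-s⁶)^{1/3}/(1+s⁶)` inside `(0,1)`:
`H'(s) = 6s⁴(1-s⁶)^{-2/3} - 36s⁴(1-s⁶)^{1/3}/(1+s⁶)²` (with `a = (1-s⁶)^{1/3}` both sides are
rational in `s, a`, and the identity holds modulo `a³ = 1-s⁶`). -/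
theorem link25_H_hasDerivAt {s : ℝ} (hs : s ∈ Ioo (0:ℝ) 1) :
    HasDerivAt (fun s : ℝ => -6 * s ^ 5 * (1 - s ^ 6) ^ ((1:ℝ) / 3) / (1 + s ^ 6))
      (6 * s ^ 4 * (1 - s ^ 6) ^ (-(2:ℝ) / 3) -
        36 * s ^ 4 * (1 - s ^ 6) ^ ((1:ℝ) / 3) / (1 + s ^ 6) ^ 2) s := by
  have hs0 : 0 < s := hs.1
  have hu : 0 < 1 - s ^ 6 := (link25_sextic_mem_Ioo hs).1
  have hv : 0 < 1 + s ^ 6 := link25_den_pos s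
  have h5 : HasDerivAt (fun s : ℝ => -6 * s ^ 5) (-6 * (5 * s ^ 4)) s := by
    simpa using (hasDerivAt_pow 5 s).const_mul (-6)
  have hw : HasDerivAt (fun s : ℝ => (1 - s ^ 6) ^ ((1:ℝ) / 3))
      (-(6 * s ^ 5) * ((1:ℝ) / 3) * (1 - s ^ 6) ^ ((1:ℝ) / 3 - 1)) s :=
    (link25_sextic_hasDerivAt s).rpow_const (Or.inl hu.ne')
  have hv' : HasDerivAt (fun s : ℝ => 1 + s ^ 6) (6 * s ^ 5) s := by
    simpa using (hasDerivAt_pow 6 s).const_add 1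
  have hnum : HasDerivAt (fun s : ℝ => -6 * s ^ 5 * (1 - s ^ 6) ^ ((1:ℝ) / 3))
      (-6 * (5 * s ^ 4) * (1 - s ^ 6) ^ ((1:ℝ) / 3) +
        -6 * s ^ 5 * (-(6 * s ^ 5) * ((1:ℝ) / 3) * (1 - s ^ 6) ^ ((1:ℝ) / 3 - 1))) s := h5.mul hw
  refine (hnum.div hv' hv.ne').congr_deriv ?_
  rw [Real.rpow_sub_one hu.ne', show (-(2:ℝ) / 3) = (1:ℝ) / 3 * (-2) by norm_num,
    Real.rpow_mul hu.le, Real.rpow_neg (Real.rpow_nonneg hu.le _), Real.rpow_two]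
  obtain ⟨a, ha0, ha3, haq⟩ :
      ∃ a : ℝ, 0 < a ∧ a ^ 3 = 1 - s ^ 6 ∧ (1 - s ^ 6) ^ ((1:ℝ) / 3) = a :=
    ⟨_, Real.rpow_pos_of_pos hu _, link25_cbrt_pow_three hu.le, rfl⟩
  rw [haq, ← ha3]
  field_simp
  linear_combination (18 * (1 + s ^ 6)) * ha3

/-- `H` is continuous (exponent `1/3 ≥ 0`, denominator `1 + s⁶ > 0`). -/
theorem link25_H_continuous :
    Continuous (fun s : ℝ => -6 * s ^ 5 * (1 - s ^ 6) ^ ((1:ℝ) / 3) / (1 + s ^ 6)) :=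
  Continuous.div (Continuous.mul (by fun_prop)
    (Continuous.rpow_const (by fun_prop) fun _ => Or.inr (by norm_num))) (by fun_prop)
    fun s => (link25_den_pos s).ne'

/-- `H(1) = 0` (`0^{1/3} = 0`). -/
theorem link25_H_one : (fun s : ℝ => -6 * s ^ 5 * (1 - s ^ 6) ^ ((1:ℝ) / 3) / (1 + s ^ 6)) 1 = 0 := by
  simp only [one_pow, sub_self, Real.zero_rpow (by norm_num : (1:ℝ) / 3 ≠ 0)]
  simp

/-- The derivative of `T(s) = ((1-s⁶)/(1+s⁶))²` is `-(24s⁵(1-s⁶))/(1+s⁶)³`. -/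
theorem link25_T_hasDerivAt (s : ℝ) :
    HasDerivAt (fun s : ℝ => ((1 - s ^ 6) / (1 + s ^ 6)) ^ 2)
      (-(24 * s ^ 5 * (1 - s ^ 6)) / (1 + s ^ 6) ^ 3) s := by
  have hv : (1 + s ^ 6) ≠ 0 := (link25_den_pos s).ne'
  have hv' : HasDerivAt (fun s : ℝ => 1 + s ^ 6) (6 * s ^ 5) s := by
    simpa using (hasDerivAt_pow 6 s).const_add 1
  have hq : HasDerivAt (fun s : ℝ => (1 - s ^ 6) / (1 + s ^ 6))
      ((-(6 * s ^ 5) * (1 + s ^ 6) - (1 - s ^ 6) * (6 * s ^ 5)) / (1 + s ^ 6) ^ 2) s :=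
    (link25_sextic_hasDerivAt s).div hv' hv
  refine (hq.fun_pow 2).congr_deriv ?_
  simp only [Nat.cast_ofNat, pow_one, Nat.add_one_sub_one]
  field_simp
  ring

/-- `T` maps `(0,1)` into `(0,1)`. -/
theorem link25_T_mem_Ioo {s : ℝ} (hs : s ∈ Ioo (0:ℝ) 1) :
    ((1 - s ^ 6) / (1 + s ^ 6)) ^ 2 ∈ Ioo (0:ℝ) 1 := by
  have hv := link25_den_pos s
  have hr0 : 0 < (1 - s ^ 6) / (1 + s ^ 6) := div_pos (link25_sextic_mem_Ioo hs).1 hv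
  have hr1 : (1 - s ^ 6) / (1 + s ^ 6) < 1 := by rw [div_lt_one hv]; linarith [pow_pos hs.1 6]
  exact ⟨by positivity, pow_lt_one₀ hr0.le hr1 (by norm_num)⟩

/-- `T` is injective on `(0,1)` (`T(p) = T(q)` forces `p⁶ = q⁶`). -/
theorem link25_T_inj {p q : ℝ} (hp : p ∈ Ioo (0:ℝ) 1) (hq : q ∈ Ioo (0:ℝ) 1)
    (h : ((1 - p ^ 6) / (1 + p ^ 6)) ^ 2 = ((1 - q ^ 6) / (1 + q ^ 6)) ^ 2) : p = q := by
  have hpv := link25_den_pos p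
  have hqv := link25_den_pos q
  have h1 : (1 - p ^ 6) / (1 + p ^ 6) = (1 - q ^ 6) / (1 + q ^ 6) :=
    (pow_left_inj₀ (div_pos (link25_sextic_mem_Ioo hp).1 hpv).le
      (div_pos (link25_sextic_mem_Ioo hq).1 hqv).le (by norm_num)).1 h
  rw [div_eq_div_iff hpv.ne' hqv.ne'] at h1
  exact (pow_left_inj₀ hp.1.le hq.1.le (by norm_num : (6:ℕ) ≠ 0)).1 (by linarith)

/-- `T` maps `(0,1)` ONTO `(0,1)` (`T(0) = 1`, `T(1) = 0`, intermediate values). -/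
theorem link25_T_image :
    (fun s : ℝ => ((1 - s ^ 6) / (1 + s ^ 6)) ^ 2) '' Ioo (0:ℝ) 1 = Ioo 0 1 := by
  set T : ℝ → ℝ := fun s => ((1 - s ^ 6) / (1 + s ^ 6)) ^ 2 with hT
  have hT0 : T 0 = 1 := by norm_num [hT]
  have hT1 : T 1 = 0 := by norm_num [hT]
  have hcont : ContinuousOn T (Icc 0 1) :=
    (ContinuousOn.div (by fun_prop) (by fun_prop) fun s _ => (link25_den_pos s).ne').pow 2
  refine Subset.antisymm (by rintro _ ⟨s, hs, rfl⟩; exact link25_T_mem_Ioo hs) fun y hy => ?_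
  obtain ⟨s, hs, hsy⟩ : y ∈ T '' Icc 0 1 := by
    have := intermediate_value_Icc' zero_le_one hcont
    rw [hT0, hT1] at this
    exact this (Ioo_subset_Icc_self hy)
  refine ⟨s, ⟨hs.1.lt_of_ne ?_, hs.2.lt_of_ne ?_⟩, hsy⟩
  · rintro rfl; rw [hT0] at hsy; linarith [hy.2]
  · rintro rfl; rw [hT1] at hsy; linarith [hy.1]

/-- The pull-back identity of move 3: for `0 < s < 1` and `t = T(s) = ((1-s⁶)/(1+s⁶))²`,
`36s⁴(1-s⁶)^{1/3}/(1+s⁶)² = (3/2)·2^{1/3}·(t^{-1/3}(1-t)^{-1/6})·|T'(s)|`.  With the cube roots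
`a³ = 1-s⁶`, `b³ = 1+s⁶`, `c³ = 2`: `T = (a/b)⁶`, `1 - T = (cs/b)⁶`, and everything is rational
in `s, a, b, c`. -/
theorem link25_T_pullback {s : ℝ} (hs : s ∈ Ioo (0:ℝ) 1) :
    36 * s ^ 4 * (1 - s ^ 6) ^ ((1:ℝ) / 3) / (1 + s ^ 6) ^ 2 =
      (3 / 2 : ℝ) * (2:ℝ) ^ ((1:ℝ) / 3) *
          ((((1 - s ^ 6) / (1 + s ^ 6)) ^ 2) ^ (-(1:ℝ) / 3) *
            (1 - ((1 - s ^ 6) / (1 + s ^ 6)) ^ 2) ^ (-(1:ℝ) / 6)) *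
        |-(24 * s ^ 5 * (1 - s ^ 6)) / (1 + s ^ 6) ^ 3| := by
  have hs0 : 0 < s := hs.1
  have hu : 0 < 1 - s ^ 6 := (link25_sextic_mem_Ioo hs).1
  have hv : 0 < 1 + s ^ 6 := link25_den_pos s
  obtain ⟨a, ha0, ha3, haq⟩ :
      ∃ a : ℝ, 0 < a ∧ a ^ 3 = 1 - s ^ 6 ∧ (1 - s ^ 6) ^ ((1:ℝ) / 3) = a :=
    ⟨_, Real.rpow_pos_of_pos hu _, link25_cbrt_pow_three hu.le, rfl⟩
  obtain ⟨b, hb0, hb3⟩ : ∃ b : ℝ, 0 < b ∧ b ^ 3 = 1 + s ^ 6 :=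
    ⟨_, Real.rpow_pos_of_pos hv _, link25_cbrt_pow_three hv.le⟩
  obtain ⟨c, hc0, hc3, hcq⟩ : ∃ c : ℝ, 0 < c ∧ c ^ 3 = 2 ∧ (2:ℝ) ^ ((1:ℝ) / 3) = c :=
    ⟨_, Real.rpow_pos_of_pos two_pos _, link25_cbrt_pow_three zero_le_two, rfl⟩
  have hab : 0 < a / b := div_pos ha0 hb0
  have hcsb : 0 < c * s / b := by positivity
  -- `T = (a/b)⁶`, `1 - T = (cs/b)⁶`, `|T'| = -T'`
  have hT : ((1 - s ^ 6) / (1 + s ^ 6)) ^ 2 = (a / b) ^ 6 := by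
    rw [← ha3, ← hb3, ← div_pow, ← pow_mul]
  have h1T : 1 - (a / b) ^ 6 = (c * s / b) ^ 6 := by
    have ha6 : a ^ 6 = (1 - s ^ 6) ^ 2 := by rw [← ha3]; ring
    have hb6 : b ^ 6 = (1 + s ^ 6) ^ 2 := by rw [← hb3]; ring
    have hc6 : c ^ 6 = 4 := by nlinarith [hc3]
    rw [div_pow, div_pow, mul_pow, ha6, hb6, hc6]
    field_simp
    ring
  have habs : |-(24 * s ^ 5 * (1 - s ^ 6)) / (1 + s ^ 6) ^ 3| =
      24 * s ^ 5 * (1 - s ^ 6) / (1 + s ^ 6) ^ 3 := by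
    rw [neg_div, abs_neg, abs_of_pos (by positivity)]
  rw [habs, hT, h1T, link25_pow_six_rpow_neg_third hab.le, link25_pow_six_rpow_neg_sixth hcsb.le,
    haq, hcq, ← ha3, ← hb3]
  field_simp
  ring

/-- `x ↦ κ·x₀ⁿ·(1-x₀⁶)^e·(1+x₀⁶)^{e'}` (`κ, e, e' ∈ ℚ`) is `ℚ`-semialgebraic on `(0,1) ⊆ ℝ¹`: an
Euler–Mellin monomial in the three positive polynomials `x₀`, `1-x₀⁶`, `1+x₀⁶`
(`KZ.isSemialgebraicFunOn_mellinIntegrand`). -/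
theorem link25_isSemialgebraicFunOn_monomial (κ : ℚ) (n : ℕ) (e e' : ℚ) :
    IsSemialgebraicFunOn ℚ {x : Fin 1 → ℝ | x 0 ∈ Set.Ioo (0:ℝ) 1}
      (fun x => (κ : ℝ) * ((x 0) ^ n * (1 - (x 0) ^ 6) ^ ((e : ℚ) : ℝ) *
        (1 + (x 0) ^ 6) ^ ((e' : ℚ) : ℝ))) := by
  refine (isSemialgebraicFunOn_mellinIntegrand BallPeeling.isSemialgebraic_posIoo
    ![X 0, 1 - X 0 ^ 6, 1 + X 0 ^ 6] ![(n : ℚ), e, e'] κ (fun x hx k => ?_)).congr fun x _ => ?_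
  · have hx' : x 0 ∈ Ioo (0:ℝ) 1 := hx
    fin_cases k
    · simpa using hx'.1
    · simpa using (link25_sextic_mem_Ioo hx').1
    · simpa using link25_den_pos (x 0)
  · simp [mellinIntegrand_apply, Fin.prod_univ_three, mul_assoc]

/-- The integrand `6x₀⁴(1-x₀⁶)^{-2/3}` of `P` is `ℚ`-semialgebraic on `(0,1)`. -/
theorem link25_isSemialgebraicFunOn_P :
    IsSemialgebraicFunOn ℚ {x : Fin 1 → ℝ | x 0 ∈ Set.Ioo (0:ℝ) 1}
      (fun x => 6 * (x 0) ^ 4 * (1 - (x 0) ^ 6) ^ (-(2:ℝ) / 3)) := by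
  refine (link25_isSemialgebraicFunOn_monomial 6 4 (-2 / 3) 0).congr fun x _ => ?_
  simp only [Rat.cast_ofNat, Rat.cast_div, Rat.cast_neg, Rat.cast_zero, Real.rpow_zero, mul_one,
    neg_div, mul_assoc]

/-- The integrand `36x₀⁴(1-x₀⁶)^{1/3}/(1+x₀⁶)²` of `Q` is `ℚ`-semialgebraic on `(0,1)`. -/
theorem link25_isSemialgebraicFunOn_Q :
    IsSemialgebraicFunOn ℚ {x : Fin 1 → ℝ | x 0 ∈ Set.Ioo (0:ℝ) 1}
      (fun x => 36 * (x 0) ^ 4 * (1 - (x 0) ^ 6) ^ ((1:ℝ) / 3) / (1 + (x 0) ^ 6) ^ 2) := by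
  refine (link25_isSemialgebraicFunOn_monomial 36 4 (1 / 3) (-2)).congr fun x _ => ?_
  simp only [Rat.cast_ofNat, Rat.cast_div, Rat.cast_one, Rat.cast_neg]
  rw [Real.rpow_neg (link25_den_pos (x 0)).le, Real.rpow_two]
  ring

/-- The primitive `-6x₀⁵(1-x₀⁶)^{1/3}/(1+x₀⁶)` is `ℚ`-semialgebraic on `(0,1)`. -/
theorem link25_isSemialgebraicFunOn_H :
    IsSemialgebraicFunOn ℚ {x : Fin 1 → ℝ | x 0 ∈ Set.Ioo (0:ℝ) 1}
      (fun x => -6 * (x 0) ^ 5 * (1 - (x 0) ^ 6) ^ ((1:ℝ) / 3) / (1 + (x 0) ^ 6)) := by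
  refine (link25_isSemialgebraicFunOn_monomial (-6) 5 (1 / 3) (-1)).congr fun x _ => ?_
  simp only [Rat.cast_ofNat, Rat.cast_div, Rat.cast_one, Rat.cast_neg, Real.rpow_neg_one]
  ring

/-- The integrand of `Q` is integrable on `(0,1) ⊆ ℝ¹` (continuous on the compact `[0,1]`). -/
theorem link25_Q_integrableOn :
    IntegrableOn
      (fun x : Fin 1 → ℝ => 36 * (x 0) ^ 4 * (1 - (x 0) ^ 6) ^ ((1:ℝ) / 3) / (1 + (x 0) ^ 6) ^ 2)
      {x : Fin 1 → ℝ | x 0 ∈ Set.Ioo (0:ℝ) 1} := by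
  have hc : Continuous (fun s : ℝ => 36 * s ^ 4 * (1 - s ^ 6) ^ ((1:ℝ) / 3) / (1 + s ^ 6) ^ 2) :=
    Continuous.div (Continuous.mul (by fun_prop)
      (Continuous.rpow_const (by fun_prop) fun _ => Or.inr (by norm_num))) (by fun_prop)
      fun s => pow_ne_zero 2 (link25_den_pos s).ne'
  rw [integrableOn_setOf_apply_mem_iff
    (g := fun s : ℝ => 36 * s ^ 4 * (1 - s ^ 6) ^ ((1:ℝ) / 3) / (1 + s ^ 6) ^ 2)]
  exact (hc.continuousOn.integrableOn_compact isCompact_Icc).mono_set Ioo_subset_Icc_self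

/-- A `ℚ`-semialgebraic integrable function on `(0,1) ⊆ ℝ¹` defines a representation there. -/
theorem link25_exists_rep {f : (Fin 1 → ℝ) → ℝ}
    (hf : IsSemialgebraicFunOn ℚ {x : Fin 1 → ℝ | x 0 ∈ Set.Ioo (0:ℝ) 1} f)
    (hi : IntegrableOn f {x : Fin 1 → ℝ | x 0 ∈ Set.Ioo (0:ℝ) 1}) :
    ∃ r : IntegralRep 1, r.domain = {x : Fin 1 → ℝ | x 0 ∈ Set.Ioo (0:ℝ) 1} ∧ r.integrand = f :=
  ⟨⟨_, _, BallPeeling.isSemialgebraic_posIoo, hf, hi⟩, rfl, rfl⟩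

/-- **Link L2′ of the level-6 rung: `B(1/3,5/6) = (3/2)·2^{1/3}·B(2/3,5/6)` inside the
Kontsevich–Zagier calculus.** For `U = [(0,1), t^{-2/3}(1-t)^{-1/6}]` and
`V = [(0,1), (3/2)·2^{1/3}·t^{-1/3}(1-t)^{-1/6}]` (pinned by domain and integrand),
`KZ.Equivalent U V` by the chain `U ∼ P ∼ Q ∼ V`: ONE change of variables `t = 1 - s⁶` (rule (2)),
ONE exact correction (`[(0,1), H'] ∈ relations` for `H = -6s⁵(1-s⁶)^{1/3}/(1+s⁶)`, rule (3) from
the point plus the null boundary, and ONE rule-(1b) move), and ONE rational change of variables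
`t = ((1-s⁶)/(1+s⁶))²` (rule (2)). [cite: KontsevichZagier2001, §1.2 rules (1)–(3)] -/
theorem stub_link25_45 : ∀ (U V : KZ.IntegralRep 1), U.domain = {x | x 0 ∈ Set.Ioo (0:ℝ) 1} →
    Set.EqOn U.integrand (fun x => (x 0) ^ (-(2:ℝ) / 3) * (1 - x 0) ^ (-(1:ℝ) / 6)) U.domain →
    V.domain = {x | x 0 ∈ Set.Ioo (0:ℝ) 1} →
    Set.EqOn V.integrand (fun x => (3 / 2 : ℝ) * (2:ℝ) ^ ((1:ℝ) / 3) * ((x 0) ^ (-(1:ℝ) / 3) * (1 - x 0) ^ (-(1:ℝ) / 6))) V.domain →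
    KZ.Equivalent U V := by
  intro U V hUd hUi hVd hVi
  -- the Beta integrand of `U`, as a function of one variable, is integrable on `(0,1)`
  have hg : IntegrableOn (fun t : ℝ => t ^ (-(2:ℝ) / 3) * (1 - t) ^ (-(1:ℝ) / 6)) (Ioo (0:ℝ) 1) := by
    have h1 : IntegrableOn (fun x : Fin 1 → ℝ => (x 0) ^ (-(2:ℝ) / 3) * (1 - x 0) ^ (-(1:ℝ) / 6))
        U.domain :=
      U.integrableOn.congr_fun hUi (IntegralRep.measurableSet_domain_holds U)
    rw [hUd] at h1
    exact integrableOn_setOf_apply_mem_iff.1 h1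
  -- the intermediate representations `P`, `Q` and `D = [(0,1), H']`
  obtain ⟨P, hPd, hPi⟩ := link25_exists_rep link25_isSemialgebraicFunOn_P (link25_P_integrableOn hg)
  obtain ⟨Q, hQd, hQi⟩ := link25_exists_rep link25_isSemialgebraicFunOn_Q link25_Q_integrableOn
  obtain ⟨D, hDd, hDi⟩ := link25_exists_rep
    (link25_isSemialgebraicFunOn_P.fun_sub link25_isSemialgebraicFunOn_Q)
    ((link25_P_integrableOn hg).sub link25_Q_integrableOn)
  have hmem : ∀ {r : IntegralRep 1}, r.domain = {x : Fin 1 → ℝ | x 0 ∈ Set.Ioo (0:ℝ) 1} →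
      ∀ p ∈ r.domain, p 0 ∈ Ioo (0:ℝ) 1 := fun h p hp => by rw [h] at hp; exact hp
  -- Move 1 (rule (2) along `t = 1 - s⁶`): `U ∼ P`
  have hUP : Equivalent U P := by
    refine Equivalent.symm (changeOfVariablesRel_subset_relations
      (of_sub_of_mem_changeOfVariablesRel_dimOne P U (fun s => 1 - s ^ 6) (fun s => -(6 * s ^ 5))
        ?_ (fun p _ => link25_sextic_hasDerivAt (p 0))
        (fun p hp q hq h => link25_sextic_inj (hmem hPd p hp) (hmem hPd q hq) h) ?_ ?_))
    · rw [hPd]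
      exact (isSemialgebraicFunOn_aeval BallPeeling.isSemialgebraic_posIoo
        (1 - X 0 ^ 6 : MvPolynomial (Fin 1) ℚ)).congr fun x _ => by simp
    · rw [hUd, hPd]
      exact (image_fin_one link25_sextic_image).symm
    · intro p hp
      have hφp : (fun _ : Fin 1 => 1 - (p 0) ^ 6) ∈ U.domain := by
        rw [hUd]
        exact link25_sextic_mem_Ioo (hmem hPd p hp)
      rw [hPi, hUi hφp]
      exact link25_sextic_pullback (hmem hPd p hp)
  -- Move 2 (rule (3) from the point, null boundary; then rule (1b)): `[D] ∈ relations`, `P ∼ Q`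
  have hD : KZ.of D ∈ relations := by
    refine of_mem_relations_of_hasDerivAt zero_lt_one isAlgebraic_zero isAlgebraic_one
      (fun s : ℝ => -6 * s ^ 5 * (1 - s ^ 6) ^ ((1:ℝ) / 3) / (1 + s ^ 6)) D (by rw [hDd]; rfl)
      (by rw [hDd]; exact link25_isSemialgebraicFunOn_H) link25_H_continuous.continuousOn
      (fun p hp => ?_) (by simp) link25_H_one
    rw [hDi]
    exact link25_H_hasDerivAt (hmem hDd p hp)
  have hPQ : Equivalent P Q := by
    have hadd : KZ.of P - KZ.of Q - KZ.of D ∈ integrandAddRel := by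
      refine ⟨1, P, Q, D, by rw [hQd, hPd], by rw [hDd, hPd], fun x _ => ?_, rfl⟩
      simp only [Pi.add_apply, hPi, hQi, hDi]
      ring
    have h := relations.add_mem (integrandAddRel_subset_relations hadd) hD
    rwa [sub_add_cancel] at h
  -- Move 3 (rule (2) along `t = ((1-s⁶)/(1+s⁶))²`): `Q ∼ V`
  have hQV : Equivalent Q V := by
    set T : ℝ → ℝ := fun s => ((1 - s ^ 6) / (1 + s ^ 6)) ^ 2 with hT
    refine changeOfVariablesRel_subset_relations
      (of_sub_of_mem_changeOfVariablesRel_dimOne Q V T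
        (fun s => -(24 * s ^ 5 * (1 - s ^ 6)) / (1 + s ^ 6) ^ 3) ?_
        (fun p _ => link25_T_hasDerivAt (p 0))
        (fun p hp q hq h => link25_T_inj (hmem hQd p hp) (hmem hQd q hq) h) ?_ ?_)
    · rw [hQd]
      refine isSemialgebraicFunOn_ratFun₁ BallPeeling.isSemialgebraic_posIoo ((1 - X 0 ^ 6) ^ 2)
        ((1 + X 0 ^ 6) ^ 2) T (fun x _ => ?_) (fun x _ => ?_)
      · simp only [map_pow, map_add, map_one, MvPolynomial.aeval_X]
        exact pow_ne_zero 2 (link25_den_pos (x 0)).ne'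
      · simp [hT, div_pow]
    · rw [hVd, hQd]
      exact (image_fin_one link25_T_image).symm
    · intro p hp
      have hTp : (fun _ : Fin 1 => T (p 0)) ∈ V.domain := by
        rw [hVd]
        exact link25_T_mem_Ioo (hmem hQd p hp)
      rw [hQi, hVi hTp]
      exact link25_T_pullback (hmem hQd p hp)
  exact (hUP.trans hPQ).trans hQV

end Summit.KontsevichZagierPeriods.FermatIsogeny.BetaLinearSector.Sixths

end
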